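import Literature.AlgebraicGeometry.HodgeTheory.SymmetricA3NonCommBraid
import Mathlib.RingTheory.Nilpotent.Basic
import HarnessLib

/-!
# hN from NON-UNIPOTENCY: if the transport along `γ₁·γ₂` of the symmetric `A₃` unfolding is not unipotent, the two
# local monodromies do not commute (socket S2 of the programme A₃-TRACE)

Family `hodge`, layer `Literature/AlgebraicGeometry/HodgeTheory`; theorems only (no definition, no named fact). Written by
the prover seat `hodge-nonav-prover-Bx` (g16, cell `hodge-nonav`) for the binder hN `SymmetricA3NonCommutation`
(`stub_a3NonComm`) of crux K1-B `VeryGeneralSignCommutatorsInHg`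
(`Summits/HodgeConjecture/HodgeConjecture/Theses/SignSymmetricPowers.lean`, stmt-HodgeConjecture-19716); programme memo
`HOME/memos/PROGRAMME-A3-TRACE-Bx-g16.md` §1 (1).

THE ALGEBRA OF THE UNIPOTENCY VARIANT (odd fibre dimension `n`, the consumed parity). Along the one-node circle `γ₁` THE
transport is the transvection `T₁ = 1 + N₁`, `N₁ = c₁ B(·, δ) δ` with `B(δ, δ) = 0`; along the exchanged-pair circle `γ₂`
it is `T₂ = 1 + N₂`, `N₂ = c₂ (B(·, δ₀) δ₀ + B(·, δ₁) δ₁)` with `δ₀, δ₁` isotropic and orthogonal (two-nodal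
Picard–Lefschetz data; Voisin II Thm. 3.16, Cor. 3.17). So `N₁² = 0 = N₂²`; IF `T₁` and `T₂` commute then `N₁, N₂`
commute and `T₁ ≫ T₂ − 1 = N₁ + N₂ + N₂N₁` is NILPOTENT (`T₁ ≫ T₂` unipotent):

* `IsPicardLefschetzData.sq_sub_one_eq_zero_of_odd_one` / `…_two` — `(T − 1)² = 0` for THE transport of one- and two-nodal data;
* `IsPicardLefschetzData.isNilpotent_trans_sub_one_of_commute` — commuting ⇒ `T₁ ≫ T₂ − 1` nilpotent;
* **`symmetricA3NonCommutation_of_not_isNilpotent`** — hN for `(f₁, g₀, g₂, ψ, εa)` from: for every `0 < |a′| < εa`, base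
  point and circles as in hN, (i) one-nodal Picard–Lefschetz data along `γ₁`, (ii) two-nodal data along `γ₂`, (iii) THE
  transports `T₁, T₂` have `T₁ ≫ T₂ − 1` NOT nilpotent.

Input (iii) is the geometric half (localisation at the `A₃` point + Pham's eigenvector, bricks B4/B2′/B3⁺ of the memo);
(i), (ii) come from `NodalPencil.picardLefschetz_oneNode_monomial` and `picardLefschetz_exchangedPair_monomial` at the consumed
(monomial) sites. Nothing here proves hN unconditionally or HC; rung F-H1 not moved.

## References

* [VoisinHodgeII2003] C. Voisin, Hodge Theory and Complex Algebraic Geometry II, CUP 2003, §3.2.1 Thm. 3.16, Cor. 3.17.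
* [ArnoldGuseinzadeVarchenko2012] V. I. Arnold, S. M. Gusein-Zade, A. N. Varchenko, Singularities of Differentiable Maps II,
  Part I §1.3, §2.3, §5.2.
-/

noncomputable section

open CategoryTheory AlgebraicGeometry MvPolynomial
open Literature.AlgebraicTopology.SingularHomology
open Literature.AlgebraicGeometry.Motives Literature.AlgebraicGeometry.Motives.UniversalHypersurface

namespace Literature.AlgebraicGeometry.HodgeTheory

section HodgeTheory

variable {n d : ℕ} {hn : 1 ≤ n} {hd : 1 ≤ d} {hU : IsCohomologicallyLocallyTrivialOn (family ℂ n d) Set.univ}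
  {s : ComplexPoints (base ℂ n d)}

namespace IsPicardLefschetzData

/-- **Odd `n`, one node: THE transport `T` along the circle satisfies `(T − 1)² = 0`** (`T − 1 = c B(·, δ) δ` with
`B(δ, δ) = 0`). [cite: VoisinHodgeII2003, §3.2.1 Thm. 3.16 and Cor. 3.17] -/
theorem sq_sub_one_eq_zero_of_odd_one {γ : Path s s} {δ : bettiCohomology (fiberOver (family ℂ n d) s) n} {c : ℚ}
    (h : IsPicardLefschetzData n d 1 hn hd hU γ ![δ] c) (hodd : Odd n)
    {T : bettiCohomology (fiberOver (family ℂ n d) s) n ≃ₗ[ℚ] bettiCohomology (fiberOver (family ℂ n d) s) n}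
    (hT : IsRatTransport (family ℂ n d) n hU (loopClassUniv n d γ) T) :
    (T.toLinearMap - 1) ^ 2 = 0 := by
  obtain ⟨-, -, ⟨T', hT', hTx⟩, -, -, hoddC⟩ := h
  have hTT : T = T' := LinearEquiv.ext fun v => ofRatClass_injective n ((hT v).trans (hT' v).symm)
  have h0 := hoddC hodd 0
  simp only [Matrix.cons_val_fin_one] at h0
  have hN : ∀ x, (T.toLinearMap - 1) x = (c * BettiUniverse.tr ((isSmoothProjectiveFamily_family ℂ hn hd).isSmoothProjective s)
      (n + n) (BettiUniverse.cup (fiberOver (family ℂ n d) s) n n x δ)) • δ := fun x => by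
    rw [LinearMap.sub_apply, Module.End.one_apply, LinearEquiv.coe_coe, hTT, hTx x, Fin.sum_univ_one,
      Matrix.cons_val_fin_one, smul_smul, add_sub_cancel_left]
  refine LinearMap.ext fun x => ?_
  rw [pow_two, Module.End.mul_apply, LinearMap.zero_apply, hN, hN x, map_smul, LinearMap.smul_apply, map_smul, h0,
    smul_zero, mul_zero, zero_smul]

/-- **Odd `n`, two nodes: THE transport `T` along the circle satisfies `(T − 1)² = 0`** (`δ₀, δ₁` isotropic and
orthogonal). [cite: VoisinHodgeII2003, §3.2.1 Thm. 3.16 and Cor. 3.17] -/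
theorem sq_sub_one_eq_zero_of_odd_two {γ : Path s s} {δ₀ δ₁ : bettiCohomology (fiberOver (family ℂ n d) s) n} {c : ℚ}
    (h : IsPicardLefschetzData n d 2 hn hd hU γ ![δ₀, δ₁] c) (hodd : Odd n)
    {T : bettiCohomology (fiberOver (family ℂ n d) s) n ≃ₗ[ℚ] bettiCohomology (fiberOver (family ℂ n d) s) n}
    (hT : IsRatTransport (family ℂ n d) n hU (loopClassUniv n d γ) T) :
    (T.toLinearMap - 1) ^ 2 = 0 := by
  obtain ⟨-, horth, ⟨T', hT', hTx⟩, -, -, hoddC⟩ := h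
  have hTT : T = T' := LinearEquiv.ext fun v => ofRatClass_injective n ((hT v).trans (hT' v).symm)
  set B : bettiCohomology (fiberOver (family ℂ n d) s) n → bettiCohomology (fiberOver (family ℂ n d) s) n → ℚ :=
    fun x y => BettiUniverse.tr ((isSmoothProjectiveFamily_family ℂ hn hd).isSmoothProjective s) (n + n)
      (BettiUniverse.cup (fiberOver (family ℂ n d) s) n n x y) with hB
  have h00 : B δ₀ δ₀ = 0 := by have := hoddC hodd 0; simpa using this
  have h11 : B δ₁ δ₁ = 0 := by have := hoddC hodd 1; simpa using this
  have h01 : B δ₀ δ₁ = 0 := by have := horth 0 1 (by decide); simpa using this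
  have h10 : B δ₁ δ₀ = 0 := by have := horth 1 0 (by decide); simpa using this
  have hBlin : ∀ x y z (a b : ℚ), B (a • x + b • y) z = a * B x z + b * B y z := fun x y z a b => by
    simp only [hB, map_add, map_smul, LinearMap.add_apply, LinearMap.smul_apply, smul_eq_mul]
  have hN : ∀ x, (T.toLinearMap - 1) x = (c * B x δ₀) • δ₀ + (c * B x δ₁) • δ₁ := fun x => by
    rw [LinearMap.sub_apply, Module.End.one_apply, LinearEquiv.coe_coe, hTT, hTx x, Fin.sum_univ_two]
    simp only [Matrix.cons_val_zero, Matrix.cons_val_one]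
    rw [smul_add, smul_smul, smul_smul, add_sub_cancel_left]
  refine LinearMap.ext fun x => ?_
  rw [pow_two, Module.End.mul_apply, LinearMap.zero_apply, hN, hN x, hBlin, hBlin, h00, h01, h10, h11]
  simp

/-- **Commuting one-node and two-node transports (odd `n`) have a UNIPOTENT product**: `T₁ ≫ T₂ − 1 = N₁ + N₂ + N₂N₁` with
`N₁² = N₂² = 0` and `N₁N₂ = N₂N₁` is nilpotent. [cite: VoisinHodgeII2003, §3.2.1 Thm. 3.16 and Cor. 3.17]
[cite: ArnoldGuseinzadeVarchenko2012, Part I §2.3] -/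
theorem isNilpotent_trans_sub_one_of_commute {γ₁ γ₂ : Path s s} {δ : bettiCohomology (fiberOver (family ℂ n d) s) n} {c₁ : ℚ}
    {δ₀ δ₁ : bettiCohomology (fiberOver (family ℂ n d) s) n} {c₂ : ℚ}
    (h₁ : IsPicardLefschetzData n d 1 hn hd hU γ₁ ![δ] c₁) (h₂ : IsPicardLefschetzData n d 2 hn hd hU γ₂ ![δ₀, δ₁] c₂)
    (hodd : Odd n)
    {T₁ T₂ : bettiCohomology (fiberOver (family ℂ n d) s) n ≃ₗ[ℚ] bettiCohomology (fiberOver (family ℂ n d) s) n}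
    (hT₁ : IsRatTransport (family ℂ n d) n hU (loopClassUniv n d γ₁) T₁)
    (hT₂ : IsRatTransport (family ℂ n d) n hU (loopClassUniv n d γ₂) T₂) (hcomm : T₁.trans T₂ = T₂.trans T₁) :
    IsNilpotent ((T₁.trans T₂).toLinearMap - 1) := by
  have hsq₁ := sq_sub_one_eq_zero_of_odd_one h₁ hodd hT₁
  have hsq₂ := sq_sub_one_eq_zero_of_odd_two h₂ hodd hT₂
  have hc1 : (T₁.trans T₂).toLinearMap = T₂.toLinearMap * T₁.toLinearMap := rfl
  have hc2 : (T₂.trans T₁).toLinearMap = T₁.toLinearMap * T₂.toLinearMap := rfl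
  have hcommL : Commute (T₁.toLinearMap - 1) (T₂.toLinearMap - 1) := by
    have h : T₁.toLinearMap * T₂.toLinearMap = T₂.toLinearMap * T₁.toLinearMap := by rw [← hc1, ← hc2, hcomm]
    change (T₁.toLinearMap - 1) * (T₂.toLinearMap - 1) = (T₂.toLinearMap - 1) * (T₁.toLinearMap - 1)
    calc (T₁.toLinearMap - 1) * (T₂.toLinearMap - 1)
        = T₁.toLinearMap * T₂.toLinearMap - T₁.toLinearMap - T₂.toLinearMap + 1 := by noncomm_ring
      _ = T₂.toLinearMap * T₁.toLinearMap - T₁.toLinearMap - T₂.toLinearMap + 1 := by rw [h]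
      _ = (T₂.toLinearMap - 1) * (T₁.toLinearMap - 1) := by noncomm_ring
  have hM : (T₁.trans T₂).toLinearMap - 1 =
      ((T₁.toLinearMap - 1) + (T₂.toLinearMap - 1)) + (T₂.toLinearMap - 1) * (T₁.toLinearMap - 1) := by
    rw [hc1]; noncomm_ring
  rw [hM]
  have hn₁ : IsNilpotent (T₁.toLinearMap - 1) := ⟨2, hsq₁⟩
  have hn₂ : IsNilpotent (T₂.toLinearMap - 1) := ⟨2, hsq₂⟩
  refine Commute.isNilpotent_add ?_ (hcommL.isNilpotent_add hn₁ hn₂) (hcommL.symm.isNilpotent_mul_right hn₂)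
  exact Commute.add_left (hcommL.mul_right (Commute.refl _)) ((Commute.refl _).mul_right hcommL.symm)

end IsPicardLefschetzData

/-- **hN from non-unipotency (socket S2 of programme A₃-TRACE, odd `n`).** Suppose that for every `0 < |a′| < εa`,
every base point `t₀` with form `f₁ + a′ g₂ + (ψ a′/2) g₀` and every pair of circles `γ₁` (`b = (ψ a′/2) e^{2πiθ}`), `γ₂`
(`b = ψ a′ − (ψ a′/2) e^{2πiθ}`) at `t₀`: (i) there are one-nodal Picard–Lefschetz data along `γ₁`, (ii) two-nodal data
along `γ₂`, and (iii) THE transports `T₁, T₂` along `γ₁, γ₂` have `T₁ ≫ T₂ − 1` NOT nilpotent. Then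
`SymmetricA3NonCommutation n d f₁ g₀ g₂ ψ εa`: commuting `T₁, T₂` would make `T₁ ≫ T₂` unipotent
(`IsPicardLefschetzData.isNilpotent_trans_sub_one_of_commute`). [cite: VoisinHodgeII2003, §3.2.1 Thm. 3.16 and Cor. 3.17]
[cite: ArnoldGuseinzadeVarchenko2012, Part I §5.2 and §2.3] -/
theorem symmetricA3NonCommutation_of_not_isNilpotent (hn : 1 ≤ n) (hd : 1 ≤ d) (hodd : Odd n)
    {f₁ g₀ g₂ : MvPolynomial (Fin (n + 2)) ℂ} {ψ : ℂ → ℂ} {εa : ℝ}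
    (H : ∀ (hU : IsCohomologicallyLocallyTrivialOn (family ℂ n d) Set.univ) (a' : ℂ), ‖a'‖ < εa → a' ≠ 0 →
      ∀ (t₀ : ComplexPoints (base ℂ n d)), pointForm ℂ n d t₀ = f₁ + a' • g₂ + (ψ a' / 2) • g₀ →
      ∀ (γ₁ γ₂ : Path t₀ t₀),
        (∀ θ : unitInterval, pointForm ℂ n d (γ₁ θ) =
          f₁ + a' • g₂ + (ψ a' / 2 * Complex.exp (2 * Real.pi * Complex.I * ((θ : ℝ) : ℂ))) • g₀) →
        (∀ θ : unitInterval, pointForm ℂ n d (γ₂ θ) =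
          f₁ + a' • g₂ + (ψ a' - ψ a' / 2 * Complex.exp (2 * Real.pi * Complex.I * ((θ : ℝ) : ℂ))) • g₀) →
        (∃ (δ : bettiCohomology (fiberOver (family ℂ n d) t₀) n) (c₁ : ℚ),
            IsPicardLefschetzData n d 1 hn hd hU γ₁ ![δ] c₁) ∧
        (∃ (δ₀ δ₁ : bettiCohomology (fiberOver (family ℂ n d) t₀) n) (c₂ : ℚ),
            IsPicardLefschetzData n d 2 hn hd hU γ₂ ![δ₀, δ₁] c₂) ∧
        ∀ (T₁ T₂ : bettiCohomology (fiberOver (family ℂ n d) t₀) n ≃ₗ[ℚ] bettiCohomology (fiberOver (family ℂ n d) t₀) n),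
          IsRatTransport (family ℂ n d) n hU (loopClassUniv n d γ₁) T₁ →
          IsRatTransport (family ℂ n d) n hU (loopClassUniv n d γ₂) T₂ →
          ¬ IsNilpotent ((T₁.trans T₂).toLinearMap - 1)) :
    SymmetricA3NonCommutation n d f₁ g₀ g₂ ψ εa := by
  intro hU a' ha ha0 t₀ ht₀ γ₁ γ₂ hγ₁ hγ₂ T₁ T₂ hT₁ hT₂ hcomm
  obtain ⟨⟨δ, c₁, h₁⟩, ⟨δ₀, δ₁, c₂, h₂⟩, hnn⟩ := H hU a' ha ha0 t₀ ht₀ γ₁ γ₂ hγ₁ hγ₂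
  exact hnn T₁ T₂ hT₁ hT₂ (IsPicardLefschetzData.isNilpotent_trans_sub_one_of_commute h₁ h₂ hodd hT₁ hT₂ hcomm)

end HodgeTheory

end Literature.AlgebraicGeometry.HodgeTheory

end
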